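import Summits.CriticalPhenomena.CardyFormulaZ2.Theorems.CardyRotToConfR2SymmetryUpgradeTipSeparationGen
import Summits.CriticalPhenomena.CardyFormulaZ2.Theorems.CardyRotToConfR2SymmetryUpgradeBranchComponents
import Summits.CriticalPhenomena.CardyFormulaZ2.Theorems.CardyRotToConfR2SymmetryUpgrade.Negative.SurgFatGerm
import Literature.Probability.RandomPlanarGeometry.ChordalRestrictionMarkov
import Mathlib.Topology.Connected.LocallyConnected
import HarnessLib

/-!
# The firing-tip lemma of the fat-germ surgery (stub `stub_fatSurgeryMarkovTip`, line
# `germ-label-transport`, crux `CardyRotToConfR2SymmetryUpgrade`, stmt-CriticalPhenomena-0698)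

Markov property of the fat-germ one-shot surgery: the surgery's kernel and the family's kernel
could only disagree at a Jordan remaining domain `(D₂; z, b)`, `D₂ = remainingDomain D p`,
`z = p.target`, `b = D.pt 1`, that FIRES at its tip `z`. This never happens when the past `p` is a
curve from `a = D.pt 0` with Lebesgue-null range in `closure D` and `D` does not fire at `a`
(`stub_fatSurgeryMarkovTip`).

Proof. `K = p.range` is compact and connected, `a, z ∈ K`, `V = D₂ ⊆ D ∖ K`.
* If `K ⊆ {z}` then `z = a`, `K = {a}` misses the open `D` (`a ∈ ∂D`), so
  `remainingDomain D p = D` (`remainingDomain_eq_carrier_of_disjoint`) and the claim is the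
  hypothesis on `D`.
* Otherwise `K` has a point `k ≠ z` and the generalised tip separation `stub_tipSeparationGen`
  says that NOT both boundary branches of `∂D₂` at `z` carry points of `∂D ∖ K` with parameters
  arbitrarily close to `D₂.mark 0`. Since `∂V ⊆ ∂D ∪ K` (`V` is a union of components of the open
  set `D ∖ K`: `frontier_remainingDomain_subset`), one whole branch `D₂.boundary '' (m, m + ε)` or
  `D₂.boundary '' (m - ε, m)` lies in the null set `K`. By `stub_branchComponents` that branch, cut
  at its first exit from `ball z r`, is a connected component of the punctured boundary
  `branchSet V z r` accumulating at `z`, for every small `r`; a null component accumulating at the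
  tip forbids `FatBothSides` (`not_fatBothSides_of_null_component`), hence forbids firing.

References: W. Werner, *Lectures on two-dimensional critical percolation* (2007), §3.2 (remaining
domain); M. H. A. Newman, *Elements of the topology of plane sets of points* (1939), Ch. V §11.
-/

noncomputable section

open Set Metric Topology Filter MeasureTheory

namespace Summit.CriticalPhenomena.CardyFormulaZ2.Theorems.CardyRotToConfR2SymmetryUpgrade

open Literature.Probability.RandomPlanarGeometry
open Summit.CriticalPhenomena.CardyFormulaZ2.Theorems.CardyRotToConfR2SymmetryUpgrade.Negative

namespace MarkovTip

/-- **The frontier of the remaining domain** lies in `∂D ∪ p.range`: the remaining domain `V` is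
a union of connected components of the open set `O = D ∖ p.range` (saturated under
`connectedComponentIn O`), these components are open (the plane is locally connected), so a
frontier point of `V` inside `O` would lie in a component meeting `V`, hence in `V`; frontier
points off `O` are in `p.range` or in `closure D ∖ D = ∂D`. [folklore] -/
theorem frontier_remainingDomain_subset (D : DobrushinDomain) (p : CurveClass ℂ) :
    frontier (remainingDomain D p) ⊆ frontier D.carrier ∪ p.range := by
  set O : Set ℂ := D.carrier \ p.range with hO_def
  have hO : IsOpen O := D.isOpen.sdiff p.isCompact_range.isClosed
  have hVO : remainingDomain D p ⊆ O := remainingDomain_subset D p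
  -- `V` is saturated under the components of `O`
  have hsat : ∀ x ∈ remainingDomain D p, connectedComponentIn O x ⊆ remainingDomain D p := by
    intro x hx y hy
    refine ⟨connectedComponentIn_subset _ _ hy, ?_⟩
    rw [← connectedComponentIn_eq hy]
    exact hx.2
  have hVopen : IsOpen (remainingDomain D p) := isOpen_iff_mem_nhds.2 fun x hx =>
    Filter.mem_of_superset
      ((hO.connectedComponentIn).mem_nhds (mem_connectedComponentIn (hVO hx))) (hsat x hx)
  intro x hx
  rw [hVopen.frontier_eq] at hx
  obtain ⟨hxcl, hxV⟩ := hx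
  by_cases hxO : x ∈ O
  · exfalso
    obtain ⟨y, hyC, hyV⟩ := _root_.mem_closure_iff.1 hxcl _ hO.connectedComponentIn
      (mem_connectedComponentIn hxO)
    have h := hsat y hyV
    rw [← connectedComponentIn_eq hyC] at h
    exact hxV (h (mem_connectedComponentIn hxO))
  · by_cases hxK : x ∈ p.range
    · exact Or.inr hxK
    · left
      have hxD : x ∉ D.carrier := fun h => hxO ⟨h, hxK⟩
      rw [D.isOpen.frontier_eq]
      exact ⟨closure_mono (hVO.trans fun _ h => h.1) hxcl, hxD⟩

/-- **A null forward branch forbids fatness.** If the forward boundary branch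
`J.boundary '' (m, m + ε)` of a Jordan domain lies in a Lebesgue-null set `K`, then `J` is not fat
on both sides at `J.boundary m`: for every small `r` the branch cut at its first exit from
`ball (J.boundary m) r` is a connected component of the punctured boundary accumulating at
`J.boundary m` (`stub_branchComponents`) and contained in `K`. [folklore] -/
theorem not_fatBothSides_of_forward_branch (J : JordanDomain) {m ε : ℝ} (hε : 0 < ε)
    (hε1 : ε ≤ 1 / 2) {K : Set ℂ} (hK : volume K = 0)
    (hsub : ∀ s ∈ Ioo m (m + ε), J.boundary s ∈ K) :
    ¬ FatBothSides J.carrier (J.boundary m) := by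
  have hne : J.boundary (m + ε) ≠ J.boundary m :=
    BranchComponents.boundary_ne_of_mem_Ioo J ⟨by linarith, by linarith⟩
  have hρ : 0 < dist (J.boundary (m + ε)) (J.boundary m) := dist_pos.2 hne
  refine not_fatBothSides_of_null_component hρ fun r hr => ?_
  have hout : J.boundary (m + ε) ∉ ball (J.boundary m) r := fun h =>
    lt_asymm (mem_ball.1 h) hr.2
  obtain ⟨δ₁, δ₂, hδ₁, -, -, hin₁, -, hC₁, -, -⟩ :=
    stub_branchComponents J m r hr.1 ⟨m + ε, hout⟩
  have hδε : δ₁ ≤ ε := by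
    by_contra h
    push Not at h
    exact hout (hin₁ ⟨m + ε, ⟨by linarith, by linarith⟩, rfl⟩)
  have hx : J.boundary (m + δ₁ / 2) ∈ J.boundary '' Ioo m (m + δ₁) :=
    ⟨_, ⟨by linarith, by linarith⟩, rfl⟩
  have hbS : branchSet J.carrier (J.boundary m) r =
      (frontier J.carrier ∩ ball (J.boundary m) r) \ {J.boundary m} := rfl
  refine ⟨J.boundary (m + δ₁ / 2), ?_, K, hK, ?_, ?_⟩
  · exact mem_branchSet.2 ⟨J.boundary_mem_frontier _, mem_ball.1 (hin₁ hx),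
      BranchComponents.boundary_ne_of_mem_Ioo J ⟨by linarith, by linarith⟩⟩
  · rw [hbS, hC₁ _ hx]
    have hm : m ∈ closure (Ioo m (m + δ₁)) := by
      rw [closure_Ioo (by linarith : m ≠ m + δ₁)]
      exact ⟨le_rfl, by linarith⟩
    exact image_closure_subset_closure_image J.continuous_boundary ⟨m, hm, rfl⟩
  · rw [hbS, hC₁ _ hx]
    rintro _ ⟨s, hs, rfl⟩
    exact hsub s ⟨hs.1, by linarith [hs.2]⟩

/-- **A null backward branch forbids fatness**: the mirror image of
`not_fatBothSides_of_forward_branch` for the branch `J.boundary '' (m - ε, m)`. [folklore] -/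
theorem not_fatBothSides_of_backward_branch (J : JordanDomain) {m ε : ℝ} (hε : 0 < ε)
    (hε1 : ε ≤ 1 / 2) {K : Set ℂ} (hK : volume K = 0)
    (hsub : ∀ s ∈ Ioo (m - ε) m, J.boundary s ∈ K) :
    ¬ FatBothSides J.carrier (J.boundary m) := by
  have hne : J.boundary (m - ε) ≠ J.boundary m := fun h =>
    (BranchComponents.boundary_ne_of_mem_Ioo J (t₀ := m - ε) (u := m)
      ⟨by linarith, by linarith⟩) h.symm
  have hρ : 0 < dist (J.boundary (m - ε)) (J.boundary m) := dist_pos.2 hne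
  refine not_fatBothSides_of_null_component hρ fun r hr => ?_
  have hout : J.boundary (m - ε) ∉ ball (J.boundary m) r := fun h =>
    lt_asymm (mem_ball.1 h) hr.2
  obtain ⟨δ₁, δ₂, -, hδ₂, -, -, hin₂, -, hC₂, -⟩ :=
    stub_branchComponents J m r hr.1 ⟨m - ε, hout⟩
  have hδε : δ₂ ≤ ε := by
    by_contra h
    push Not at h
    exact hout (hin₂ ⟨m - ε, ⟨by linarith, by linarith⟩, rfl⟩)
  have hx : J.boundary (m - δ₂ / 2) ∈ J.boundary '' Ioo (m - δ₂) m :=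
    ⟨_, ⟨by linarith, by linarith⟩, rfl⟩
  have hbS : branchSet J.carrier (J.boundary m) r =
      (frontier J.carrier ∩ ball (J.boundary m) r) \ {J.boundary m} := rfl
  refine ⟨J.boundary (m - δ₂ / 2), ?_, K, hK, ?_, ?_⟩
  · refine mem_branchSet.2 ⟨J.boundary_mem_frontier _, mem_ball.1 (hin₂ hx), fun h => ?_⟩
    exact BranchComponents.boundary_ne_of_mem_Ioo J (t₀ := m - δ₂ / 2) (u := m)
      ⟨by linarith, by linarith⟩ h.symm
  · rw [hbS, hC₂ _ hx]
    have hm : m ∈ closure (Ioo (m - δ₂) m) := by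
      rw [closure_Ioo (by linarith : m - δ₂ ≠ m)]
      exact ⟨by linarith, le_rfl⟩
    exact image_closure_subset_closure_image J.continuous_boundary ⟨m, hm, rfl⟩
  · rw [hbS, hC₂ _ hx]
    rintro _ ⟨s, hs, rfl⟩
    exact hsub s ⟨by linarith [hs.1], hs.2⟩

end MarkovTip

open MarkovTip in
/-- **S7f. The firing-tip lemma.** If the Dobrushin domain `D` does not fire at `a = D.pt 0` and
`p` is a curve class from `a` with Lebesgue-null range in `closure D`, then a Dobrushin domain
`D₂` whose carrier is the remaining domain `remainingDomain D p`, marked at `(p.target, D.pt 1)`,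
does not fire at its tip `D₂.pt 0 = p.target`. Trivial past (`p.range ⊆ {tip}`): the remaining
domain is `D` and the tip is `a`. Otherwise, by the generalised tip separation
(`stub_tipSeparationGen`) and `∂D₂ ⊆ ∂D ∪ p.range`, one boundary branch of `∂D₂` at the tip lies
in the null set `p.range`, and a null branch component accumulating at the tip forbids
`FatBothSides` (`stub_branchComponents`, `not_fatBothSides_of_null_component`).
[cite: Werner2007, §3.2] -/
theorem stub_fatSurgeryMarkovTip : ∀ (D D₂ : DobrushinDomain) (p : CurveClass ℂ), ¬ Summit.CriticalPhenomena.CardyFormulaZ2.Theorems.CardyRotToConfR2SymmetryUpgrade.Negative.Fires D.carrier (D.pt 0) → p.source = D.pt 0 → p.range ⊆ closure D.carrier → MeasureTheory.volume p.range = 0 → D₂.carrier = remainingDomain D p → D₂.pt 0 = p.target → D₂.pt 1 = D.pt 1 → ¬ Summit.CriticalPhenomena.CardyFormulaZ2.Theorems.CardyRotToConfR2SymmetryUpgrade.Negative.Fires D₂.carrier (D₂.pt 0) := by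
  intro D D₂ p hD hsrc hKcl hKnull hV hz hb hfire
  -- the past `K`, containing `a = D.pt 0` and the tip `z = D₂.pt 0`
  have haK : D.pt 0 ∈ p.range := hsrc ▸ p.source_mem_range
  have hzK : D₂.pt 0 ∈ p.range := hz ▸ p.target_mem_range
  have haD : D.pt 0 ∉ D.carrier := fun h => by
    have hf := D.pt_mem_frontier 0
    rw [D.isOpen.frontier_eq] at hf
    exact hf.2 h
  by_cases hk : ∃ k ∈ p.range, k ≠ D₂.pt 0
  · -- nontrivial past: tip separation, then a null branch
    have hKconn : IsConnected p.range := by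
      obtain ⟨γ, rfl⟩ := CurveClass.surjective_mk p
      rw [CurveClass.range_mk]
      exact isConnected_range γ.continuous
    have hVD : D₂.carrier ⊆ D.carrier := fun x hx => by
      rw [hV] at hx
      exact (remainingDomain_subset D p hx).1
    have hKV : Disjoint p.range D₂.carrier := by
      rw [Set.disjoint_left]
      intro x hxK hxV
      rw [hV] at hxV
      exact (remainingDomain_subset D p hxV).2 hxK
    have hfrV : frontier D₂.carrier ⊆ frontier D.carrier ∪ p.range := by
      rw [hV]
      exact frontier_remainingDomain_subset D p
    have hzdef : D₂.pt 0 = D₂.boundary (D₂.mark 0) := rfl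
    -- points of a branch whose `∂D`-points are all in `K` are all in `K`
    have hbranch : ∀ s : ℝ, (D₂.boundary s ∈ frontier D.carrier → D₂.boundary s ∈ p.range) →
        D₂.boundary s ∈ p.range := fun s hs => by
      rcases hfrV (D₂.boundary_mem_frontier s) with h | h
      · exact hs h
      · exact h
    refine stub_tipSeparationGen D D₂ p.range hVD hb hKconn hKcl hzK hk hKV fun ε hε => ?_
    have hε' : 0 < min ε (1 / 2) := lt_min hε (by norm_num)
    have hε1 : min ε (1 / 2) ≤ 1 / 2 := min_le_right _ _
    have hεε : min ε (1 / 2) ≤ ε := min_le_left _ _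
    constructor
    · by_contra hbad
      push Not at hbad
      exact not_fatBothSides_of_forward_branch D₂.toJordanDomain hε' hε1 hKnull
        (fun s hs => hbranch s fun hsF => hbad s ⟨hs.1, lt_of_lt_of_le hs.2 (by linarith)⟩ hsF)
        (hzdef ▸ hfire.1)
    · by_contra hbad
      push Not at hbad
      exact not_fatBothSides_of_backward_branch D₂.toJordanDomain hε' hε1 hKnull
        (fun s hs => hbranch s fun hsF => hbad s ⟨lt_of_le_of_lt (by linarith) hs.1, hs.2⟩ hsF)
        (hzdef ▸ hfire.1)
  · -- trivial past: `K = {a}`, the remaining domain is `D` and the tip is `a`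
    push Not at hk
    have hza : D₂.pt 0 = D.pt 0 := (hk _ haK).symm
    have hdisj : Disjoint D.carrier p.range := by
      rw [Set.disjoint_right]
      intro x hx
      rw [hk x hx, hza]
      exact haD
    have hVD : D₂.carrier = D.carrier := by
      rw [hV]
      exact remainingDomain_eq_carrier_of_disjoint D hdisj
    rw [hVD, hza] at hfire
    exact hD hfire

end Summit.CriticalPhenomena.CardyFormulaZ2.Theorems.CardyRotToConfR2SymmetryUpgrade

end
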